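import Summits.BirchSwinnertonDyer.BirchSwinnertonDyer.Theorems.InertBadSignedBranchesInertBadAtThreeIstarZeroManinFromDegree
import Summits.BirchSwinnertonDyer.Rank1Residual.X12.InertBadThreeInstancesATamagawa
import Summits.BirchSwinnertonDyer.Rank1Residual.X12.CMTwistKodairaOdd
import Summits.BirchSwinnertonDyer.Rank1Residual.X12.InertBadLocalTypesThree
import Literature.NumberTheory.EllipticCurves.NoEverywhereGoodReductionRat
import Literature.NumberTheory.GaloisRepresentations.HeckeCharacterProofs
import HarnessLib

/-!
# Route `InertBadSignedBranches` (rung K8), D71 child `InertBadAtThreeIstarZero` (stmt-BirchSwinnertonDyer-19656):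
# the member `484416bw1 = [0, 0, 0, 7569, 0]` of the type `(3, I₀*)` — the one O10-PS@3 census class whose
# `X₀(N)`-optimal curve is undetermined — and the child's conclusion at it with the Manin input READ OFF
# THE MODULAR DEGREE (helper `--supports` 19656; cell `bsd-cm`, seat `bsd-cm-k8i-c41` g3; nothing asserted)

HONEST FRAMING (cell `bsd-cm`, run/shared/lean/pub/bsd-cm/): Birch–Swinnerton-Dyer is NOT proved by
any of this. The item `InertBadAtThreeIstarZero` is OPEN at class level and stays so. This file is a
per-pair RECORD in the style of x1b's T-KR@3 records and of this seat's witnesses `E₁₅ = 7200bg1` (g0,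
p418526) and `441d1` (p428956): the curve `484416bw1` (`y² = x³ + 87²x`, `j = 1728`, CM by `ℤ[i]`,
`N = 484416 = 2⁶·3²·29²`, `Δ = −2⁶·3⁶·29⁶`) is the one class of the 57 O10-PS@3 census classes for which
Cremona's `opt_man` leaves the optimal curve undetermined (∈ {bw1, bw2, bw3}; N18 v1.2, x1b T-KR3-154
`TKR3_inputs_met = NO`), so the per-pair Manin datum of route T-KR@3 was pending. Here the Manin input
comes from the MODULAR DEGREE instead (this seat's `InertBadManinDegree.*`, p429901/p431282:
Česnavičius–Neururer–Saha Thm. 1.2; `deg φ(bw1) = 716800 = 2¹²·5²·7`, `3 ∤`, Cremona `alldegphi`).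
No definition is introduced: every statement is keyed by the equation `W = [0, 0, 0, 7569, 0]` (as g0's
`E₁₅` file is keyed by `C • W = E₁₅`), the caller supplying `[W.IsElliptic]` (e.g. by
`X11b.isElliptic_of_discOf_ne_zero 0 0 0 7569 0`); global minimality is PROVED inside (Kraus).
THEOREMS ONLY: 0 definitions, 0 named facts minted, 0 `sorry`.

PARTITION (D-0054): CornerF inert-bad (B12 / O10) × the pair (`484416bw1`, `3`) ∈ O10-PS@3 (`d_K = −4`,
`(H_Δ)@3` holds: `𝔣′ = (1+i)⁴·𝔮₂₉𝔮̄₂₉`, `φ = 8·28² ` prime to `3`) × `p = 3` — types-the-object-of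
(membership UNCONDITIONAL; the conclusion at the member is CONDITIONAL on published facts + CNS + three
certified data: `r_an = 1`, `3 ∤ deg φ`, `ord₃ #Ш_an = 0`); closes no cell, books nothing, moves no mark
(per-pair bookkeeping: O10-PS@3 inputs met 57/57 with a kernel route for the last class).

* §1 the model: `Δ`, `j = 1728`, global minimality (Kraus), bad at `3` and at `2`, Kodaira `I₀*` at the
  place over `3` (`87²`-twist of `[0, 0, 0, 1, 0]`, `v₃(87) = 1`, x1b's `kodairaSymbolAt_twist_of_valuation_eq`),
  hence `hasSignedLocalType_three_of_eq_c484416bw1` — UNCONDITIONAL.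
* §2 `missingInputAt_three_of_eq_c484416bw1` — the child's conclusion at the member (facts + CNS +
  `r_an = 1` + a datum `D` with `3 ∤ deg(D)` + `#Ш_an` a `3`-adic unit), via
  `InertBadManinDegree.missingInputAt_three_IstarZero_of_shaAn_unit_of_modularDegree`; and
  `inertBadAtThreeIstarZero_at_eq_c484416bw1` in the item's own shape.

References (locators only): [Cremona1997] `allbsd` / `alldegphi` / `opt_man` (class 484416bw);
[CesnaviciusNeururerSaha2023] Thm. 1.2; [MatarNekovar2019] Thm. 0.3, §0.11; [SilvermanATAEC1994] IV.9.4
Step 6, Table 4.1; [SilvermanAEC2009] VII.1 Remark 1.1, VII.5 Prop. 5.1(a); [Kraus1989] Prop. 1–2;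
[Miller2011LMS] §1, Def. 1.1.
-/

set_option autoImplicit false
set_option linter.dupNamespace false

noncomputable section

open scoped Classical NumberField

open WeierstrassCurve NumberField IsDedekindDomain IsDedekindDomain.HeightOneSpectrum
  Rat.HeightOneSpectrum
open Literature.NumberTheory.EllipticCurves
open Literature.NumberTheory.GaloisRepresentations
open Literature.NumberTheory.EllipticCurves.ModularForms
open Literature.NumberTheory.EllipticCurves.Rank1Residual
open Literature.NumberTheory.EllipticCurves.Rank1Residual.Typed
open Summit.BirchSwinnertonDyer.Rank1Residual
open Summit.BirchSwinnertonDyer.Rank1Residual.X12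
open Summit.BirchSwinnertonDyer.Rank1Residual.X12.O10
open Summit.BirchSwinnertonDyer.BirchSwinnertonDyer.Rank1Residual.X11RankOne

namespace Summit.BirchSwinnertonDyer.BirchSwinnertonDyer.Theorems.InertBadAtThreeWitness

/-! ## §1 The model `484416bw1 = [0, 0, 0, 7569, 0]` — UNCONDITIONAL facts -/

/-- `Δ([0,0,0,7569,0]) = −27752076864576 = −2⁶·3⁶·29⁶`. [cite: Cremona1997, Table 1 (curve 484416bw1)] -/
theorem Δ_of_eq_c484416bw1 (W : WeierstrassCurve ℚ)
    (hW : W = ⟨((0 : ℤ) : ℚ), ((0 : ℤ) : ℚ), ((0 : ℤ) : ℚ), ((7569 : ℤ) : ℚ), ((0 : ℤ) : ℚ)⟩) :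
    W.Δ = -27752076864576 := by
  subst hW
  norm_num [WeierstrassCurve.Δ, WeierstrassCurve.b₂, WeierstrassCurve.b₄, WeierstrassCurve.b₆,
    WeierstrassCurve.b₈]

/-- `j([0,0,0,7569,0]) = 1728` (`c₆ = 0`). [cite: Cremona1997, Table 1 (curve 484416bw1)] -/
theorem j_of_eq_c484416bw1 (W : WeierstrassCurve ℚ) [W.IsElliptic]
    (hW : W = ⟨((0 : ℤ) : ℚ), ((0 : ℤ) : ℚ), ((0 : ℤ) : ℚ), ((7569 : ℤ) : ℚ), ((0 : ℤ) : ℚ)⟩) :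
    W.j = 1728 := by
  have hΔ := Δ_of_eq_c484416bw1 W hW
  have hc₄ : W.c₄ = -363312 := by
    subst hW; norm_num [WeierstrassCurve.c₄, WeierstrassCurve.b₂, WeierstrassCurve.b₄]
  rw [j, Units.inv_mul_eq_iff_eq_mul, hc₄, coe_Δ', hΔ]
  norm_num

set_option maxRecDepth 100000 in
/-- `[0, 0, 0, 7569, 0]` is globally minimal (`Δ = −2⁶·3⁶·29⁶`: `q¹² ∤ Δ` for every prime `q`; Kraus'
bounded criterion, kernel-decided). [cite: SilvermanAEC2009, VII.1 Remark 1.1 and VIII.8] [cite: Kraus1989, Prop. 1 and Prop. 2] -/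
theorem isGloballyMinimal_of_eq_c484416bw1 (W : WeierstrassCurve ℚ)
    (hW : W = ⟨((0 : ℤ) : ℚ), ((0 : ℤ) : ℚ), ((0 : ℤ) : ℚ), ((7569 : ℤ) : ℚ), ((0 : ℤ) : ℚ)⟩) :
    W.IsGloballyMinimal := by
  subst hW
  exact isGloballyMinimal_of_krausCriterion_bounded 0 0 0 7569 0 (by decide) (by decide) (by decide +kernel)

/-- `484416bw1` is BAD at `3` (`3 ∣ Δ_min`). [cite: SilvermanAEC2009, VII.5 Prop. 5.1(a)] -/
theorem not_good_three_of_eq_c484416bw1 (W : WeierstrassCurve ℚ) [Fact (Nat.Prime 3)]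
    (hW : W = ⟨((0 : ℤ) : ℚ), ((0 : ℤ) : ℚ), ((0 : ℤ) : ℚ), ((7569 : ℤ) : ℚ), ((0 : ℤ) : ℚ)⟩) :
    ¬ Good W 3 := by
  haveI := isGloballyMinimal_of_eq_c484416bw1 W hW
  refine not_hasGoodReductionAtPrime_of_dvd_minimalDiscriminantInt W 3 ?_
  have h : (minimalDiscriminantInt W : ℚ) = ((-27752076864576 : ℤ) : ℚ) := by
    rw [cast_minimalDiscriminantInt, Δ_of_eq_c484416bw1 W hW]; norm_num
  rw [Int.cast_inj.mp h]
  norm_num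

/-- `484416bw1` is BAD at `2` (`2 ∣ Δ_min`). [cite: SilvermanAEC2009, VII.5 Prop. 5.1(a)] -/
theorem not_hasGoodReductionAtPrime_two_of_eq_c484416bw1 (W : WeierstrassCurve ℚ)
    (hW : W = ⟨((0 : ℤ) : ℚ), ((0 : ℤ) : ℚ), ((0 : ℤ) : ℚ), ((7569 : ℤ) : ℚ), ((0 : ℤ) : ℚ)⟩) :
    ¬ W.HasGoodReductionAtPrime 2 := by
  haveI : Fact (Nat.Prime 2) := ⟨Nat.prime_two⟩
  haveI := isGloballyMinimal_of_eq_c484416bw1 W hW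
  refine not_hasGoodReductionAtPrime_of_dvd_minimalDiscriminantInt W 2 ?_
  have h : (minimalDiscriminantInt W : ℚ) = ((-27752076864576 : ℤ) : ℚ) := by
    rw [cast_minimalDiscriminantInt, Δ_of_eq_c484416bw1 W hW]; norm_num
  rw [Int.cast_inj.mp h]
  norm_num

/-- **Kodaira type `I₀*` at the place over `3`**: `[0,0,0,7569,0] = [0,0,0,1,0]^{(87)}` (the quadratic twist
`y² = x³ + 87²x` of `y² = x³ + x`; `Δ₀ = −64` a `3`-unit, `v₃(87) = 1`) — Tate's algorithm Step 6 via
x1b's `kodairaSymbolAt_twist_of_valuation_eq`. UNCONDITIONAL. [cite: SilvermanATAEC1994, IV.9.4 Step 6 and Table 4.1] -/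
theorem kodairaSymbolAt_three_of_eq_c484416bw1 (W : WeierstrassCurve ℚ) [W.IsElliptic]
    (hW : W = ⟨((0 : ℤ) : ℚ), ((0 : ℤ) : ℚ), ((0 : ℤ) : ℚ), ((7569 : ℤ) : ℚ), ((0 : ℤ) : ℚ)⟩)
    (v : HeightOneSpectrum (𝓞 ℚ)) (hv : natGenerator v = 3) : W.kodairaSymbolAt v = .Istar 0 := by
  have hv2 : natGenerator v ≠ 2 := by rw [hv]; decide
  set E₀ : WeierstrassCurve ℚ := ⟨0, 0, 0, 1, 0⟩ with hE₀
  haveI : E₀.IsElliptic := by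
    rw [hE₀, show (⟨0, 0, 0, 1, 0⟩ : WeierstrassCurve ℚ) =
      ⟨((0 : ℤ) : ℚ), ((0 : ℤ) : ℚ), ((0 : ℤ) : ℚ), ((1 : ℤ) : ℚ), ((0 : ℤ) : ℚ)⟩ by norm_num]
    exact Summit.BirchSwinnertonDyer.Rank1Residual.X11b.isElliptic_of_discOf_ne_zero 0 0 0 1 0 (by decide)
  have hb₂ : v.valuation ℚ E₀.b₂ ≤ 1 := by
    rw [show E₀.b₂ = ((0 : ℤ) : ℚ) by norm_num [hE₀, WeierstrassCurve.b₂]]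
    exact valuation_ringOfIntegers_intCast_le_one v _
  have hb₄ : v.valuation ℚ E₀.b₄ ≤ 1 := by
    rw [show E₀.b₄ = ((2 : ℤ) : ℚ) by norm_num [hE₀, WeierstrassCurve.b₄]]
    exact valuation_ringOfIntegers_intCast_le_one v _
  have hb₆ : v.valuation ℚ E₀.b₆ ≤ 1 := by
    rw [show E₀.b₆ = ((0 : ℤ) : ℚ) by norm_num [hE₀, WeierstrassCurve.b₆]]
    exact valuation_ringOfIntegers_intCast_le_one v _
  have hΔ₀ : v.valuation ℚ E₀.Δ = 1 := by
    rw [show E₀.Δ = ((-64 : ℤ) : ℚ) by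
      norm_num [hE₀, WeierstrassCurve.Δ, WeierstrassCurve.b₂, WeierstrassCurve.b₄,
        WeierstrassCurve.b₆, WeierstrassCurve.b₈]]
    refine Rat.valuation_intCast_eq_one v ?_
    rw [hv]
    intro h
    have h' : (3 : ℤ) ∣ 64 := (Int.dvd_neg).mp h
    omega
  -- `ord_3 87 = 1`
  have hpv : ((primesEquiv v : ℕ) : ℤ) = 3 := by
    rw [show (primesEquiv v : ℕ) = natGenerator v from rfl, hv]; rfl
  have h1 : ((primesEquiv v : ℕ) : ℤ) ∣ (87 : ℤ) := by rw [hpv]; norm_num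
  have h2 : ¬ ((primesEquiv v : ℕ) : ℤ) ^ 2 ∣ (87 : ℤ) := by rw [hpv]; norm_num
  have hnv : v.valuation ℚ (((87 : ℤ) : ℚ)) = WithZero.exp (-1 : ℤ) :=
    valuation_ringOfIntegers_intCast_eq_exp_neg_one v h1 h2
  have hnv' : v.valuation ℚ (87 : ℚ) = WithZero.exp (-1 : ℤ) := by exact_mod_cast hnv
  have hM : E₀.quadraticTwist (87 : ℚ) = (1 : VariableChange ℚ) • W := by
    rw [one_smul, hW]
    ext <;> norm_num [hE₀, quadraticTwist, WeierstrassCurve.b₂, WeierstrassCurve.b₄, WeierstrassCurve.b₆]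
  exact kodairaSymbolAt_twist_of_valuation_eq W v hv2 E₀ hb₂ hb₄ hb₆ hΔ₀ hnv' 1 hM

/-- **`484416bw1` has signed local type `(3, I₀*)`** — CM by `ℤ[i]`, `3` INERT in `ℚ(i)` (from `j = 1728`),
bad at `3`, Kodaira `I₀*` at the place over `3`. UNCONDITIONAL (kernel) for any model equal to
`[0, 0, 0, 7569, 0]`. One of the 57 O10-PS@3 census classes (N18 §1; `d_K = −4`); its `X₀(N)`-optimal
member is undetermined in Cremona's `opt_man`. [cite: SilvermanATAEC1994, IV.9.4, Table 4.1 and App. A §3]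
[cite: Cremona1997, Table 1 / opt_man (class 484416bw)] -/
theorem hasSignedLocalType_three_of_eq_c484416bw1 (W : WeierstrassCurve ℚ) [W.IsElliptic]
    [Fact (Nat.Prime 3)]
    (hW : W = ⟨((0 : ℤ) : ℚ), ((0 : ℤ) : ℚ), ((0 : ℤ) : ℚ), ((7569 : ℤ) : ℚ), ((0 : ℤ) : ℚ)⟩) :
    HasSignedLocalType W 3 (.Istar 0) :=
  ⟨hasCM_of_j_eq_1728 _ (j_of_eq_c484416bw1 W hW), cmInert_three_of_j_eq_1728 W (j_of_eq_c484416bw1 W hW),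
    not_good_three_of_eq_c484416bw1 W hW, fun v hv ↦ kodairaSymbolAt_three_of_eq_c484416bw1 W hW v hv⟩

/-! ## §2 The child's conclusion AT the member — Manin input from the degree -/

/-- **The child's conclusion at `(484416bw1, 3)`: `Typed.X12.MissingInputAt W 3` for `W = [0,0,0,7569,0]`** —
GIVEN the eight published facts of route T-KR@3, the CNS fact `hCNS`, and the certified data `r_an = 1`
(`hr`; Cremona `allbsd`: `r = 1`), a parametrisation datum `D` at the conductor level with `3 ∤ deg(D)`
(`hdeg`; Cremona `alldegphi`: the minimal `X₀(484416)`-parametrisation of bw1 has degree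
`716800 = 2¹²·5²·7`) and `#Ш_an = q` with `ord₃ q = 0` (`hq`, `hv`; `allbsd`: `#Ш_an = 1`). No optimality
and no `c = 1` sentence is used; global minimality is proved here. RELATIVE (per-pair known regime);
CONDITIONAL on every displayed hypothesis; nothing booked; 19656 stays OPEN at class level.
[cite: CesnaviciusNeururerSaha2023, Thm. 1.2] [cite: Cremona1997, allbsd / alldegphi (curve 484416bw1)]
[cite: MatarNekovar2019, Thm. 0.3 and §0.11] [cite: Miller2011LMS, §1 and Def. 1.1] -/
theorem missingInputAt_three_of_eq_c484416bw1
    (hGZ : ∀ (N : ℕ) [NeZero N] (W : WeierstrassCurve ℚ) (K : Type) [Field K] [NumberField K],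
      gross_zagier N W K)
    (hKo : ∀ (N : ℕ) [NeZero N] (W : WeierstrassCurve ℚ) (K : Type) [Field K] [NumberField K],
      kolyvagin N W K)
    (hMN : ∀ (N : ℕ) [NeZero N] (W : WeierstrassCurve ℚ) (K : Type) [Field K] [NumberField K],
      MatarNekovar2019.thm03_padicValNat_card_sha_le_of_irreducible N W K)
    (hGZK : rank_eq_analyticRank_of_analyticRank_le_one) (hmod : hasEntireLFunction_rat)
    (hnf : exists_isNewformOf) (hFH : friedbergHoffstein_exists_heegnerField_split_twist_ne_zero)
    (hCM8 : bsdTriple_of_hasCM_of_L_one_ne_zero)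
    (hCNS : cesnaviciusNeururerSaha_padicVal_maninConstant_le_modularDegree)
    (W : WeierstrassCurve ℚ) [W.IsElliptic] [Fact (Nat.Prime 3)] [NeZero (W.conductorNorm ℤ)]
    (hW : W = ⟨((0 : ℤ) : ℚ), ((0 : ℤ) : ℚ), ((0 : ℤ) : ℚ), ((7569 : ℤ) : ℚ), ((0 : ℤ) : ℚ)⟩)
    (hr : W.analyticRank = 1)
    (D : ModularParametrizationData W (W.conductorNorm ℤ)) (hdeg : ¬ 3 ∣ D.modularDegree)
    {q : ℚ} (hq : shaAn W = (q : ℂ)) (hv : padicValRat 3 q = 0) :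
    X12.MissingInputAt W 3 := by
  haveI := isGloballyMinimal_of_eq_c484416bw1 W hW
  exact InertBadManinDegree.missingInputAt_three_IstarZero_of_shaAn_unit_of_modularDegree hGZ hKo hMN
    hGZK hmod hnf hFH hCM8 hCNS W (hasSignedLocalType_three_of_eq_c484416bw1 W hW) hr
    (not_hasGoodReductionAtPrime_two_of_eq_c484416bw1 W hW) D hdeg hq hv

/-- **RELATIVE WITNESS for the child `InertBadAtThreeIstarZero` at the member `(484416bw1, 3)`** (the
optimality-pending class): the member IS of signed local type `(3, I₀*)` (unconditional), and — given the
published facts, the CNS fact, a datum `D` with `3 ∤ deg(D)` and the certified `3`-adic unit `#Ш_an` —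
the item's implication `r_an = 1 → Typed.X12.MissingInputAt W 3` holds at it. The class-level child stays
OPEN; nothing booked. [cite: CesnaviciusNeururerSaha2023, Thm. 1.2] [cite: MatarNekovar2019, Thm. 0.3 and §0.11]
[cite: SilvermanATAEC1994, IV.9.4 and Table 4.1] [cite: Miller2011LMS, §1 and Def. 1.1] -/
theorem inertBadAtThreeIstarZero_at_eq_c484416bw1
    (hGZ : ∀ (N : ℕ) [NeZero N] (W : WeierstrassCurve ℚ) (K : Type) [Field K] [NumberField K],
      gross_zagier N W K)
    (hKo : ∀ (N : ℕ) [NeZero N] (W : WeierstrassCurve ℚ) (K : Type) [Field K] [NumberField K],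
      kolyvagin N W K)
    (hMN : ∀ (N : ℕ) [NeZero N] (W : WeierstrassCurve ℚ) (K : Type) [Field K] [NumberField K],
      MatarNekovar2019.thm03_padicValNat_card_sha_le_of_irreducible N W K)
    (hGZK : rank_eq_analyticRank_of_analyticRank_le_one) (hmod : hasEntireLFunction_rat)
    (hnf : exists_isNewformOf) (hFH : friedbergHoffstein_exists_heegnerField_split_twist_ne_zero)
    (hCM8 : bsdTriple_of_hasCM_of_L_one_ne_zero)
    (hCNS : cesnaviciusNeururerSaha_padicVal_maninConstant_le_modularDegree)
    (W : WeierstrassCurve ℚ) [W.IsElliptic] [Fact (Nat.Prime 3)] [NeZero (W.conductorNorm ℤ)]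
    (hW : W = ⟨((0 : ℤ) : ℚ), ((0 : ℤ) : ℚ), ((0 : ℤ) : ℚ), ((7569 : ℤ) : ℚ), ((0 : ℤ) : ℚ)⟩)
    (D : ModularParametrizationData W (W.conductorNorm ℤ)) (hdeg : ¬ 3 ∣ D.modularDegree)
    {q : ℚ} (hq : shaAn W = (q : ℂ)) (hv : padicValRat 3 q = 0) :
    HasSignedLocalType W 3 (.Istar 0) ∧ (W.analyticRank = 1 → X12.MissingInputAt W 3) :=
  ⟨hasSignedLocalType_three_of_eq_c484416bw1 W hW,
    fun hr ↦ missingInputAt_three_of_eq_c484416bw1 hGZ hKo hMN hGZK hmod hnf hFH hCM8 hCNS W hW hr D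
      hdeg hq hv⟩

end Summit.BirchSwinnertonDyer.BirchSwinnertonDyer.Theorems.InertBadAtThreeWitness

end
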